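import Literature.Analysis.OperatorTheory.YangMillsMatrixModelGroundStateSign
import HarnessLib

/-!
# The positive invariant ground state of Lüscher's matrix-model Hamiltonian is unique

Topic `Literature/Analysis/OperatorTheory`; companion of `YangMillsMatrixModelGroundStateSign.lean` (a colour-invariant `C²`
solution of `𝔥ψ = E₁ψ`, `E₁ = physLevel 1`, with `|ψ| ≤ Ce^{−‖x‖}` is everywhere `> 0` or everywhere `< 0`) and of
`YangMillsMatrixModelLuscherSimonGapHolds.lean` (`physLevel 1 < physLevel 2`).  Here the classical UNIQUENESS statement is proved
for CONCRETE eigenfunctions: **two colour-invariant `C²` solutions `ψ₁, ψ₂` of `𝔥ψ = E₁ψ` with exponential decay, both `L²`-normalised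
(`∫ ψ_i² = 1`) and both strictly positive, are EQUAL** (Lieb–Loss Thm 11.8 «uniqueness of the positive minimizer»; Reed–Simon IV
Thm XIII.47–48; Courant–Hilbert VI §6).

PROOF.  `ψ = ψ₁ − ψ₂` is again a colour-invariant `C²` solution with exponential decay (linearity, `hApply_sum_mul`); if `ψ ≢ 0`
then by the sign dichotomy `groundState_pos_or_neg` either `ψ₁ > ψ₂` everywhere or `ψ₁ < ψ₂` everywhere; both being positive,
`ψ₁² − ψ₂²` is then a continuous integrable function of strict constant sign, so `∫ψ₁² − ∫ψ₂² ≠ 0`, contradicting the two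
normalisations.

* `hApply_sub` — `𝔥(ψ₁ − ψ₂) = 𝔥ψ₁ − 𝔥ψ₂` pointwise on `C²` functions;
* `integrable_sq_of_abs_le_exp` — `ψ²` is integrable under `|ψ| ≤ Ce^{−‖x‖}`;
* ★ `groundState_eq_of_pos` — the uniqueness statement above;
* `groundState_eq_of_clauses` — for two families `f, f'` with the five clauses of `LuscherHamiltonianEigenfunctions` (AL1) and
  positive ground states, `f 0 = f' 0`: the positive AL1 ground state is ONE canonical function.

Theorems only; no definitions, no named facts, no instances.

## References
* [LiebLoss2001] E. H. Lieb, M. Loss, *Analysis*, 2nd ed., Thm 11.8 (uniqueness and positivity of minimizers, PDF pp. 205–206).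
* [ReedSimonIV1978] M. Reed, B. Simon, *Methods of Modern Mathematical Physics IV*, §XIII.12 Thm XIII.47–48.
-/

noncomputable section

open MeasureTheory Filter Topology
open scoped BigOperators

namespace Literature.Analysis.OperatorTheory.YMMatrixModel

/-! ### 1. Linearity and integrability -/

/-- `𝔥` is additive up to sign: `𝔥(ψ₁ − ψ₂)(x) = 𝔥ψ₁(x) − 𝔥ψ₂(x)` for `ψ₁, ψ₂ ∈ C²` (linearity of `Δ`; the two-term case of
`hApply_sum_mul`). [cite: ReedSimonIV1978, Thm. XIII.2] -/
theorem hApply_sub {ψ₁ ψ₂ : ZM → ℝ} (h₁ : ContDiff ℝ 2 ψ₁) (h₂ : ContDiff ℝ 2 ψ₂) (x : ZM) :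
    hApply (ψ₁ - ψ₂) x = hApply ψ₁ x - hApply ψ₂ x := by
  set f : Fin 2 → ZM → ℝ := ![ψ₁, ψ₂] with hf
  set a : Fin 2 → ℝ := ![1, -1] with ha
  have hfc : ∀ j, ContDiff ℝ 2 (f j) := fun j => by
    fin_cases j
    · simpa [hf] using h₁
    · simpa [hf] using h₂
  have hfun : ψ₁ - ψ₂ = fun y => ∑ j, a j * f j y := by
    funext y
    simp [Fin.sum_univ_two, ha, hf, sub_eq_add_neg]
  rw [hfun, hApply_sum_mul (k := 1) hfc a x]
  simp [Fin.sum_univ_two, ha, hf, sub_eq_add_neg]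

/-- `ψ²` is integrable on `ℝ⁹` when `ψ` is continuous with `|ψ| ≤ Ce^{−‖x‖}`. [cite: LiebLoss2001, Thm. 11.8] -/
theorem integrable_sq_of_abs_le_exp {ψ : ZM → ℝ} (hc : Continuous ψ) {C : ℝ} (hC : ∀ x, |ψ x| ≤ C * Real.exp (-‖x‖)) :
    Integrable (fun x => ψ x * ψ x) (volume : Measure ZM) := by
  have h := (memLp_two_iff_integrable_sq hc.aestronglyMeasurable).1 (memLp_two_of_abs_le_exp hc hC)
  refine h.congr (Eventually.of_forall fun x => ?_)
  simp [sq]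

/-! ### 2. Uniqueness of the positive normalised ground state -/

/-- ★ **Uniqueness of the positive invariant ground state of `𝔥`.**  Two colour-invariant `C²` solutions of `𝔥ψ = physLevel 1 · ψ` on
`ℝ⁹` with exponential decay `|ψ_i| ≤ C_i e^{−‖x‖}`, both `L²`-normalised (`∫ψ_i² = 1`) and both strictly positive, coincide.
(The difference has a strict sign by `groundState_pos_or_neg` unless it vanishes; a strict sign contradicts the equal norms.)
[cite: LiebLoss2001, Thm. 11.8, PDF pp. 205–206] [cite: ReedSimonIV1978, Thm. XIII.47–48] -/
theorem groundState_eq_of_pos {ψ₁ ψ₂ : ZM → ℝ} (h₁ : ContDiff ℝ 2 ψ₁) (h₂ : ContDiff ℝ 2 ψ₂)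
    (hinv₁ : IsGaugeInv ψ₁) (hinv₂ : IsGaugeInv ψ₂)
    (heig₁ : ∀ x, hApply ψ₁ x = physLevel 1 * ψ₁ x) (heig₂ : ∀ x, hApply ψ₂ x = physLevel 1 * ψ₂ x)
    (hdec₁ : ∃ C : ℝ, ∀ x, |ψ₁ x| ≤ C * Real.exp (-‖x‖)) (hdec₂ : ∃ C : ℝ, ∀ x, |ψ₂ x| ≤ C * Real.exp (-‖x‖))
    (hnorm₁ : ∫ x, ψ₁ x * ψ₁ x = (1 : ℝ)) (hnorm₂ : ∫ x, ψ₂ x * ψ₂ x = (1 : ℝ))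
    (hpos₁ : ∀ x, 0 < ψ₁ x) (hpos₂ : ∀ x, 0 < ψ₂ x) : ψ₁ = ψ₂ := by
  obtain ⟨C₁, hC₁⟩ := hdec₁
  obtain ⟨C₂, hC₂⟩ := hdec₂
  have hc₁ : Continuous ψ₁ := h₁.continuous
  have hc₂ : Continuous ψ₂ := h₂.continuous
  have hI₁ := integrable_sq_of_abs_le_exp hc₁ hC₁
  have hI₂ := integrable_sq_of_abs_le_exp hc₂ hC₂
  by_contra hne
  -- the difference is a decaying invariant `C²` solution at the ground level
  set ψ : ZM → ℝ := ψ₁ - ψ₂ with hψ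
  have hψ2 : ContDiff ℝ 2 ψ := h₁.sub h₂
  have hψinv : IsGaugeInv ψ := fun R hR x => by
    simp only [hψ, Pi.sub_apply, hinv₁ R hR x, hinv₂ R hR x]
  have hψeig : ∀ x, hApply ψ x = physLevel 1 * ψ x := fun x => by
    rw [hψ, hApply_sub h₁ h₂, heig₁, heig₂, Pi.sub_apply, mul_sub]
  have hψdec : ∃ C : ℝ, ∀ x, |ψ x| ≤ C * Real.exp (-‖x‖) := ⟨C₁ + C₂, fun x => by
    calc |ψ x| = |ψ₁ x - ψ₂ x| := rfl
      _ ≤ |ψ₁ x| + |ψ₂ x| := abs_sub _ _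
      _ ≤ C₁ * Real.exp (-‖x‖) + C₂ * Real.exp (-‖x‖) := add_le_add (hC₁ x) (hC₂ x)
      _ = (C₁ + C₂) * Real.exp (-‖x‖) := by ring⟩
  have hψne : ∃ x, ψ x ≠ 0 := by
    by_contra h
    exact hne (funext fun x => sub_eq_zero.1 (not_not.1 (not_exists.1 h x)))
  -- the difference of the squares is integrable with integral zero
  have hdiff : ∫ x, (ψ₁ x * ψ₁ x - ψ₂ x * ψ₂ x) = 0 := by
    rw [integral_sub hI₁ hI₂, hnorm₁, hnorm₂, sub_self]
  have hvol : (0 : ENNReal) < volume (Set.univ : Set ZM) := isOpen_univ.measure_pos volume Set.univ_nonempty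
  rcases groundState_pos_or_neg hψ2 hψinv hψeig hψdec hψne with hpos | hneg
  · -- `ψ₁ > ψ₂ > 0` everywhere: `∫(ψ₁² − ψ₂²) > 0`
    have hpt : ∀ x, 0 < ψ₁ x * ψ₁ x - ψ₂ x * ψ₂ x := fun x => by
      have h12 : ψ₂ x < ψ₁ x := sub_pos.1 (hpos x)
      nlinarith [hpos₂ x, h12]
    have hsupp : Function.support (fun x => ψ₁ x * ψ₁ x - ψ₂ x * ψ₂ x) = Set.univ :=
      Set.eq_univ_of_forall fun x => (hpt x).ne'
    have hint : 0 < ∫ x, (ψ₁ x * ψ₁ x - ψ₂ x * ψ₂ x) := by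
      rw [integral_pos_iff_support_of_nonneg (fun x => (hpt x).le) (hI₁.sub hI₂), hsupp]
      exact hvol
    exact absurd hdiff hint.ne'
  · -- `ψ₂ > ψ₁ > 0` everywhere: `∫(ψ₁² − ψ₂²) < 0`
    have hpt : ∀ x, 0 < ψ₂ x * ψ₂ x - ψ₁ x * ψ₁ x := fun x => by
      have h12 : ψ₁ x < ψ₂ x := sub_neg.1 (hneg x)
      nlinarith [hpos₁ x, h12]
    have hsupp : Function.support (fun x => ψ₂ x * ψ₂ x - ψ₁ x * ψ₁ x) = Set.univ :=
      Set.eq_univ_of_forall fun x => (hpt x).ne'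
    have hint : 0 < ∫ x, (ψ₂ x * ψ₂ x - ψ₁ x * ψ₁ x) := by
      rw [integral_pos_iff_support_of_nonneg (fun x => (hpt x).le) (hI₂.sub hI₁), hsupp]
      exact hvol
    have hdiff' : ∫ x, (ψ₂ x * ψ₂ x - ψ₁ x * ψ₁ x) = 0 := by
      rw [integral_sub hI₂ hI₁, hnorm₁, hnorm₂, sub_self]
    exact absurd hdiff' hint.ne'

/-! ### 3. AL1 families: the positive ground state is canonical -/

/-- **Two AL1 families with positive ground states share the ground state.**  If `f_0, …, f_k` and `f'_0, …, f'_{k'}` both satisfy the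
five clauses of `LuscherHamiltonianEigenfunctions` (smooth, colour-invariant, `L²`-orthonormal, classical eigenfunctions at
`physLevel (j+1)`, `ExpDecay₂`) and `f_0 > 0`, `f'_0 > 0`, then `f_0 = f'_0`. [cite: LiebLoss2001, Thm. 11.8] [cite: ReedSimonIV1978, Thm. XIII.47–48] -/
theorem groundState_eq_of_clauses {k k' : ℕ} {f : Fin (k + 1) → ZM → ℝ} {f' : Fin (k' + 1) → ZM → ℝ}
    (hsmooth : ∀ j, ∀ n : ℕ∞, ContDiff ℝ n (f j)) (hinv : ∀ j, IsGaugeInv (f j))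
    (horth : ∀ i j, ∫ x, f i x * f j x = if i = j then (1 : ℝ) else 0)
    (heig : ∀ j, ∀ x : ZM, hApply (f j) x = physLevel ((j : ℕ) + 1) * f j x) (hdec : ∀ j, ExpDecay₂ (f j))
    (hpos : ∀ x, 0 < f 0 x)
    (hsmooth' : ∀ j, ∀ n : ℕ∞, ContDiff ℝ n (f' j)) (hinv' : ∀ j, IsGaugeInv (f' j))
    (horth' : ∀ i j, ∫ x, f' i x * f' j x = if i = j then (1 : ℝ) else 0)
    (heig' : ∀ j, ∀ x : ZM, hApply (f' j) x = physLevel ((j : ℕ) + 1) * f' j x) (hdec' : ∀ j, ExpDecay₂ (f' j))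
    (hpos' : ∀ x, 0 < f' 0 x) : f 0 = f' 0 := by
  have heig0 : ∀ x, hApply (f 0) x = physLevel 1 * f 0 x := fun x => by
    have h := heig 0 x
    simp only [Fin.val_zero, zero_add] at h
    exact h
  have heig0' : ∀ x, hApply (f' 0) x = physLevel 1 * f' 0 x := fun x => by
    have h := heig' 0 x
    simp only [Fin.val_zero, zero_add] at h
    exact h
  obtain ⟨C, -, hC⟩ := (hdec 0).exists_abs_le
  obtain ⟨C', -, hC'⟩ := (hdec' 0).exists_abs_le
  have hn : ∫ x, f 0 x * f 0 x = (1 : ℝ) := by rw [horth 0 0, if_pos rfl]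
  have hn' : ∫ x, f' 0 x * f' 0 x = (1 : ℝ) := by rw [horth' 0 0, if_pos rfl]
  exact groundState_eq_of_pos (contDiff_two_of_forall (hsmooth 0)) (contDiff_two_of_forall (hsmooth' 0)) (hinv 0) (hinv' 0)
    heig0 heig0' ⟨C, hC⟩ ⟨C', hC'⟩ hn hn' hpos hpos'

end Literature.Analysis.OperatorTheory.YMMatrixModel

end
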